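import Literature.AlgebraicGeometry.HodgeTheory.WeilFamilyReachSystem
import Literature.AlgebraicGeometry.HodgeTheory.FlatSectionNonvanishing
import Literature.AlgebraicGeometry.Motives.AbelianVarietyIsogenyPairFlip
import HarnessLib

/-!
# The reach fact through a hyperbolic abelian `2n`-fold, minus its polarization class, from the family-first fact

Family `hodge`, layer `Literature/AlgebraicGeometry/HodgeTheory`; theorems only (no definition, no
named fact). The two named facts

* `weilFamilyReach_hyperbolic` (`HodgeTheory/WeilFamilyReach`; quantifiers `∀ w, ∀ (A, φ), ∃ family`,
  WITH the relative polarization class `H` — clause (a) — and the non-vanishing of the transported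
  class at the reached fibre, isogeny oriented `u : A → A'` TO the fibre), and
* `weilFamily_hyperbolic_weilSystem_reach` (`HodgeTheory/WeilFamilyReachSystem`; ONE family per
  `(P, ψ₀, h_K)` serving every Weil class and every target, Weil planes of all fibres recorded, NO
  polarization class, NO non-vanishing, isogeny oriented `u : Y_s → A` FROM the fibre)

render the same two pages of [Deligne1982HodgeCycles, proof of Thm. 4.8] (LNM 900, pp. 47–52) with
[vanGeemen1994HodgeAV, 5.2–5.11]. This file proves how much of the first is BOOKKEEPING over the
second on the tree's real carriers:

* `weilFamilyReach_core_of_weilSystem` —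
  `weilFamily_hyperbolic_weilSystem_reach →` every clause of `weilFamilyReach_hyperbolic` except the
  two clauses about `H` (fibrewise rational `(1,1)`, `e'^*(H|_{s₀}) = h_K`), with the reaching
  `K`-isogeny in the orientation of the source fact (`u : A' → A` finite flat, `v : A → A'`,
  `u ≫ v = [m]`, `v` intertwining `φ` and `φ'`). The one clause that is not a projection is the
  NON-VANISHING of the transported Weil class at the reached fibre: the flat section through
  `e'^{-1 *} w`, `w ≠ 0`, vanishes nowhere, because `S(ℂ)` is path connected (irreducible ⟹ connected
  in the complex topology, SGA1 XII 2.4, and smooth ⟹ topological manifold) and transport in the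
  local system `R^{2n} f_* ℂ` (Ehresmann) is injective and carries continuous sections into
  themselves (`HodgeTheory/FlatSectionNonvanishing`).
* `weilFamilyReach_noClass_of_weilSystem` — the same with the reaching `K`-isogeny in the
  orientation of `weilFamilyReach_hyperbolic` (`u : A → A'` finite flat, `v : A' → A`, `u ≫ v = [m]`,
  `v ≫ φ = φ' ≫ v`), i.e. `weilFamily_hyperbolic_weilSystem_reach →` EVERY clause of
  `weilFamilyReach_hyperbolic` except the two about `H`, verbatim. The isogeny pair is flipped by
  the tree's proved isogeny theory (`Motives/AbelianVarietyIsogenyPairFlip`: half an isogeny pair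
  between abelian varieties of the same dimension is an isogeny; its quasi-inverse — Mumford §19,
  Remark p. 169 — is an isogeny, hence flat, Görtz–Wedhorn II 27.54; equivariance transfers because
  isogenies and `[m]` are epimorphisms, Görtz–Wedhorn II 27.178).

* `weilFamilyReach_hyperbolic_of_polarizedWeilSystem` — the exact residual debt, in Lean: the
  family-first package TOGETHER WITH clause (a) for the same family (a class `H ∈ H²(𝒳(ℂ); ℂ)`,
  rational `(1,1)` on every fibre, `e'^*(H|_{s₀}) = h_K`; hypothesis stated inline, no named fact
  minted) implies `weilFamilyReach_hyperbolic`; and `…_weilSystem_reach_of_polarizedWeilSystem` —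
  it implies the family-first fact by forgetting `H`.

So the residual content of `weilFamilyReach_hyperbolic` over its family-first sibling is exactly
the relative polarization class `H = q·c₁` of the universal polarization with its normalisation at
`s₀` (Deligne, loc. cit., p. 50: the family is a family of POLARIZED abelian varieties;
[MumfordFogartyKirwan1994, Thm. 7.9]): clause (a) of the fact, fibrewise rational of type `(1,1)`
with `e'^*(H|_{s₀}) = h_K`. A constructor of the universal PEL family over the hyperbolic component
delivering the hypothesis of `weilFamilyReach_hyperbolic_of_polarizedWeilSystem` discharges BOTH
named facts.

## References

* [Deligne1982HodgeCycles] P. Deligne (notes by J. S. Milne), Hodge cycles on abelian varieties,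
  LNM 900 (1982), proof of Thm. 4.8 (pp. 47–52), Prop. 4.4.
* [vanGeemen1994HodgeAV] B. van Geemen, LNM 1594 (1994), Lemma 5.2, 5.3–5.4, 5.8–5.11.
* [VoisinHodgeI2002] C. Voisin, Hodge Theory and Complex Algebraic Geometry I, §9.2.1, Thm. 9.3.
* [VoisinHodgeII2003] C. Voisin, Hodge Theory and Complex Algebraic Geometry II, Lemma 4.17.
* [Milne1986AbelianVarieties] J. S. Milne, Abelian Varieties, §8 Prop. 8.1.
* [MumfordAV1970] D. Mumford, Abelian Varieties (1970), §19, Remark p. 169.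
* [GortzWedhorn2023] U. Görtz, T. Wedhorn, Algebraic Geometry II (2023), Prop. 27.54, 27.178, 27.190.
-/

noncomputable section

namespace Literature.AlgebraicGeometry.HodgeTheory

open CategoryTheory
open Literature.AlgebraicGeometry Literature.AlgebraicGeometry.Motives
open Literature.AlgebraicTopology.SingularHomology

/-- **`weilFamilyReach_hyperbolic` without its polarization class, from the family-first fact.**
For `n, d ≥ 1`, a hyperbolic `(P, ψ₀, h_K)` (`ψ₀² = -d`, `dim P = 2n`, `h_K = d·e^*a + ψ₀^*e^*a`), a
non-zero Weil class `w` of `(P, ψ₀)` and a hyperbolic target `(A, φ, h_K(A))` of the same `(2n, d)`: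
the family `f : 𝒳 → S` of `weilFamily_hyperbolic_weilSystem_reach` through `P ≅ 𝒳_{s₀}` (embedded
smooth projective, base irreducible smooth quasi-projective, all fibres `√-d`-abelian `2n`-folds),
its flat section `σ` through `e'^{-1 *} w` (continuous, of Hodge type `(n, n)` on every fibre), the
reached fibre `A' := Y_{s₁} ≅ 𝒳_{s₁}` with its `K`-isogeny pair `u : A' → A` (finite flat),
`v : A → A'`, `u ≫ v = [m]`, `m ≥ 1`, `v ≫ φ' = φ ≫ v`, and the value `σ(s₁) = (s₁, w₁)`, a Weil class
of `(A', φ')` read in the chart `e₁`, which is NON-ZERO (flat sections through a non-zero class vanish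
nowhere: `FiberClass.ne_zero_of_isSmoothProjectiveFamily_of_eq_mk`). Every clause of
`weilFamilyReach_hyperbolic` except the two about the class `H`, with the isogeny in the orientation
of the source fact. [cite: Deligne1982HodgeCycles, proof of Thm. 4.8 (pp. 47–52) with Prop. 4.4]
[cite: vanGeemen1994HodgeAV, Lemma 5.2, 5.3–5.4 and 5.8–5.11] [cite: VoisinHodgeII2003, Lemma 4.17] -/
theorem weilFamilyReach_core_of_weilSystem (h : weilFamily_hyperbolic_weilSystem_reach) :
    ∀ (n d : ℕ), 1 ≤ n → 1 ≤ d →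
    ∀ (P : AbelianVariety ℂ) (ψ₀ : P ⟶ P) (e : ProjectiveEmbedding P.X)
      (a : complexBetti (projectiveSpace e.n ℂ) 2),
      P.dim = 2 * n → ψ₀ ≫ ψ₀ = -(d • 𝟙 P) → IsRationalClass a → a ≠ 0 →
      IsHyperbolicWeilType P ψ₀ n
        ((d : ℂ) • complexBetti.map e.ι 2 a + complexBetti.map ψ₀.hom.hom.hom 2 (complexBetti.map e.ι 2 a)) →
    ∀ w : complexBetti P.X (2 * n), w ∈ weilClassesOf P ψ₀ n d → w ≠ 0 →
    ∀ (A : AbelianVariety ℂ) (φ : A ⟶ A) (eA : ProjectiveEmbedding A.X)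
      (aA : complexBetti (projectiveSpace eA.n ℂ) 2),
      A.dim = 2 * n → φ ≫ φ = -(d • 𝟙 A) → IsRationalClass aA → aA ≠ 0 →
      IsHyperbolicWeilType A φ n
        ((d : ℂ) • complexBetti.map eA.ι 2 aA +
          complexBetti.map φ.hom.hom.hom 2 (complexBetti.map eA.ι 2 aA)) →
      ∃ (𝒳 S : SchemeOver ℂ) (f : 𝒳 ⟶ S) (s₀ s₁ : ComplexPoints S) (e' : P.X ≅ fiberOver f s₀)
        (A' : AbelianVariety ℂ) (φ' : A' ⟶ A') (e₁ : A'.X ≅ fiberOver f s₁)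
        (σ : ComplexPoints S → FiberClass f (2 * n)),
        IsSmoothProjectiveFamily f (2 * n) ∧
        (∃ (N : ℕ) (ι : 𝒳 ⟶ CategoryTheory.MonoidalCategoryStruct.tensorObj (projectiveSpace N ℂ) S),
          AlgebraicGeometry.IsClosedImmersion ι.left ∧
            ι ≫ CategoryTheory.CartesianMonoidalCategory.snd (projectiveSpace N ℂ) S = f) ∧
        IrreducibleSpace S.left ∧ AlgebraicGeometry.Smooth S.hom ∧ IsQuasiProjectiveOver S ∧
        (∀ s : ComplexPoints S, ∃ (A'' : AbelianVariety ℂ) (φ'' : A'' ⟶ A''),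
          A''.dim = 2 * n ∧ φ'' ≫ φ'' = -(d • 𝟙 A'') ∧ Nonempty (A''.X ≅ fiberOver f s)) ∧
        Continuous σ ∧ (∀ s, (σ s).pt = s) ∧
        (∀ s, IsOfHodgeType (2 * n) (fiberOver f (σ s).pt) (2 * n) n n (σ s).cls) ∧
        σ s₀ = ⟨s₀, complexBetti.map e'.inv (2 * n) w⟩ ∧
        A'.dim = 2 * n ∧ φ' ≫ φ' = -(d • 𝟙 A') ∧
        (∃ (u : A' ⟶ A) (v : A ⟶ A') (m : ℕ), 0 < m ∧ u ≫ v = m • 𝟙 A' ∧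
          AlgebraicGeometry.Flat u.hom.hom.hom.left ∧ v ≫ φ' = φ ≫ v) ∧
        ∃ w₁ : complexBetti (fiberOver f s₁) (2 * n),
          σ s₁ = ⟨s₁, w₁⟩ ∧ complexBetti.map e₁.hom (2 * n) w₁ ∈ weilClassesOf A' φ' n d ∧
            complexBetti.map e₁.hom (2 * n) w₁ ≠ 0 := by
  intro n d hn hd P ψ₀ e a hP hψ ha ha0 hhyp w hw hw0 A φ eA aA hA hφ haA haA0 hhypA
  have hψ' : ψ₀ ≫ ψ₀ = -((d : ℤ) • 𝟙 P) := by rw [natCast_zsmul]; exact hψ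
  have hφ' : φ ≫ φ = -((d : ℤ) • 𝟙 A) := by rw [natCast_zsmul]; exact hφ
  obtain ⟨𝒳, S, f, s₀, e', Y, Ψ, ε, hfam, hemb, hirr, hsm, hqp, hYΨ, hsec, hreach⟩ :=
    h n d hn hd P ψ₀ e a hP hψ' ha ha0 hhyp
  obtain ⟨σ, hσ, hσ₀, hval⟩ := hsec w hw
  obtain ⟨s₁, u, v, m, hu, hm, huv, hv⟩ := hreach A φ eA aA hA hφ' haA haA0 hhypA
  have hpt : ∀ s, (σ s).pt = s := fun s ↦ by
    obtain ⟨x, hx, -, -⟩ := hval s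
    rw [hx]
  obtain ⟨x₁, hx₁, -, hx₁W⟩ := hval s₁
  refine ⟨𝒳, S, f, s₀, s₁, e', Y s₁, Ψ s₁, ε s₁, σ, hfam, hemb, hirr, hsm, hqp, fun s ↦ ?_, hσ, hpt,
    fun s ↦ ?_, hσ₀, (hYΨ s₁).1, ?_, ⟨u, v, m, hm, huv, hu, hv⟩, x₁, hx₁, hx₁W, ?_⟩
  · -- every fibre is a `√-d`-abelian `2n`-fold
    exact ⟨Y s, Ψ s, (hYΨ s).1, by rw [(hYΨ s).2, natCast_zsmul], ⟨ε s⟩⟩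
  · -- the values of `σ` are of Hodge type `(n, n)`
    obtain ⟨x, hx, hH, -⟩ := hval s
    rw [hx]
    exact hH
  · rw [(hYΨ s₁).2, natCast_zsmul]
  · -- the transported class is non-zero: flat sections through `e'^{-1 *} w ≠ 0` vanish nowhere
    refine complexBetti.map_ne_zero_of_iso (ε s₁) (2 * n) ?_
    exact FiberClass.ne_zero_of_isSmoothProjectiveFamily_of_eq_mk f (2 * n) hfam hirr hsm hqp hσ hpt
      hσ₀ (complexBetti.map_ne_zero_of_iso e'.symm (2 * n) hw0) hx₁

/-- **`weilFamilyReach_hyperbolic` without its polarization class, VERBATIM, from the family-first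
fact**: for `n, d ≥ 1`, a hyperbolic `(P, ψ₀, h_K)`, a non-zero Weil class `w` of `(P, ψ₀)` and a
hyperbolic target `(A, φ, h_K(A))` of the same `(2n, d)`, every clause of `weilFamilyReach_hyperbolic`
except the two about the class `H` — the family through `P ≅ 𝒳_{s₀}`, its flat section `σ` through
`e'^{-1 *} w` of Hodge type `(n, n)` everywhere, the reached fibre `A' ≅ 𝒳_{s₁}` with `φ'² = -d`,
the `K`-isogeny `u : A → A'` (finite flat) with `v : A' → A`, `u ≫ v = [m]`, `m ≥ 1`,
`v ≫ φ = φ' ≫ v`, and the NON-ZERO value `σ(s₁)` in the Weil plane of `(A', φ')`. Proof: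
`weilFamilyReach_core_of_weilSystem`, then flip the isogeny pair it provides (from the fibre) with
`Motives.AbelianVariety.exists_isogenyPair_flip` (`dim A' = 2n = dim A`, characteristic `0`).
[cite: Deligne1982HodgeCycles, proof of Thm. 4.8 (pp. 47–52) with Prop. 4.4]
[cite: vanGeemen1994HodgeAV, Lemma 5.2, 5.3–5.4 and 5.8–5.11]
[cite: Milne1986AbelianVarieties, §8 Prop. 8.1] [cite: MumfordAV1970, §19 Remark p. 169] -/
theorem weilFamilyReach_noClass_of_weilSystem (h : weilFamily_hyperbolic_weilSystem_reach) :
    ∀ (n d : ℕ), 1 ≤ n → 1 ≤ d →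
    ∀ (P : AbelianVariety ℂ) (ψ₀ : P ⟶ P) (e : ProjectiveEmbedding P.X)
      (a : complexBetti (projectiveSpace e.n ℂ) 2),
      P.dim = 2 * n → ψ₀ ≫ ψ₀ = -(d • 𝟙 P) → IsRationalClass a → a ≠ 0 →
      IsHyperbolicWeilType P ψ₀ n
        ((d : ℂ) • complexBetti.map e.ι 2 a + complexBetti.map ψ₀.hom.hom.hom 2 (complexBetti.map e.ι 2 a)) →
    ∀ w : complexBetti P.X (2 * n), w ∈ weilClassesOf P ψ₀ n d → w ≠ 0 →
    ∀ (A : AbelianVariety ℂ) (φ : A ⟶ A) (eA : ProjectiveEmbedding A.X)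
      (aA : complexBetti (projectiveSpace eA.n ℂ) 2),
      A.dim = 2 * n → φ ≫ φ = -(d • 𝟙 A) → IsRationalClass aA → aA ≠ 0 →
      IsHyperbolicWeilType A φ n
        ((d : ℂ) • complexBetti.map eA.ι 2 aA +
          complexBetti.map φ.hom.hom.hom 2 (complexBetti.map eA.ι 2 aA)) →
      ∃ (𝒳 S : SchemeOver ℂ) (f : 𝒳 ⟶ S) (s₀ s₁ : ComplexPoints S) (e' : P.X ≅ fiberOver f s₀)
        (A' : AbelianVariety ℂ) (φ' : A' ⟶ A') (e₁ : A'.X ≅ fiberOver f s₁)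
        (σ : ComplexPoints S → FiberClass f (2 * n)),
        IsSmoothProjectiveFamily f (2 * n) ∧
        (∃ (N : ℕ) (ι : 𝒳 ⟶ CategoryTheory.MonoidalCategoryStruct.tensorObj (projectiveSpace N ℂ) S),
          AlgebraicGeometry.IsClosedImmersion ι.left ∧
            ι ≫ CategoryTheory.CartesianMonoidalCategory.snd (projectiveSpace N ℂ) S = f) ∧
        IrreducibleSpace S.left ∧ AlgebraicGeometry.Smooth S.hom ∧ IsQuasiProjectiveOver S ∧
        (∀ s : ComplexPoints S, ∃ (A'' : AbelianVariety ℂ) (φ'' : A'' ⟶ A''),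
          A''.dim = 2 * n ∧ φ'' ≫ φ'' = -(d • 𝟙 A'') ∧ Nonempty (A''.X ≅ fiberOver f s)) ∧
        Continuous σ ∧ (∀ s, (σ s).pt = s) ∧
        (∀ s, IsOfHodgeType (2 * n) (fiberOver f (σ s).pt) (2 * n) n n (σ s).cls) ∧
        σ s₀ = ⟨s₀, complexBetti.map e'.inv (2 * n) w⟩ ∧
        A'.dim = 2 * n ∧ φ' ≫ φ' = -(d • 𝟙 A') ∧
        (∃ (u : A ⟶ A') (v : A' ⟶ A) (m : ℕ), 0 < m ∧ u ≫ v = m • 𝟙 A ∧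
          AlgebraicGeometry.Flat u.hom.hom.hom.left ∧ v ≫ φ = φ' ≫ v) ∧
        ∃ w₁ : complexBetti (fiberOver f s₁) (2 * n),
          σ s₁ = ⟨s₁, w₁⟩ ∧ complexBetti.map e₁.hom (2 * n) w₁ ∈ weilClassesOf A' φ' n d ∧
            complexBetti.map e₁.hom (2 * n) w₁ ≠ 0 := by
  intro n d hn hd P ψ₀ e a hP hψ ha ha0 hhyp w hw hw0 A φ eA aA hA hφ haA haA0 hhypA
  obtain ⟨𝒳, S, f, s₀, s₁, e', A', φ', e₁, σ, hfam, hemb, hirr, hsm, hqp, hfib, hσ, hpt, hH, hσ₀,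
      hA', hφ', ⟨u, v, m, hm, huv, -, hv⟩, hw₁⟩ :=
    weilFamilyReach_core_of_weilSystem h n d hn hd P ψ₀ e a hP hψ ha ha0 hhyp w hw hw0 A φ eA aA
      hA hφ haA haA0 hhypA
  -- flip the isogeny pair `u : A' → A`, `v : A → A'` (`dim A' = dim A`, characteristic `0`)
  obtain ⟨u', v', m', hm', hu'v', -, -, -, hfl, hv'φ, -⟩ :=
    AbelianVariety.exists_isogenyPair_flip hm huv (hA'.trans hA.symm) hv
  exact ⟨𝒳, S, f, s₀, s₁, e', A', φ', e₁, σ, hfam, hemb, hirr, hsm, hqp, hfib, hσ, hpt, hH, hσ₀, hA',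
    hφ', ⟨u', v', m', hm', hu'v', hfl, hv'φ⟩, hw₁⟩

/-- **`weilFamilyReach_hyperbolic` from the family-first fact WITH its polarization class** — the
exact residual debt. If Deligne's family-first package over the hyperbolic component (the clauses of
`weilFamily_hyperbolic_weilSystem_reach`, VERBATIM) is available TOGETHER WITH clause (a) of
`weilFamilyReach_hyperbolic` for the same family — a class `H ∈ H²(𝒳(ℂ); ℂ)`, rational of type
`(1,1)` on every fibre, with `e'^*(H|_{s₀}) = h_K` (the class `q·c₁` of the universal polarization:
[Deligne1982HodgeCycles, proof of Thm. 4.8, p. 50], the family is a family of POLARIZED abelian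
varieties; [MumfordFogartyKirwan1994, Thm. 7.9]) — then `weilFamilyReach_hyperbolic` holds. The
hypothesis is stated inline (it is the statement a constructor of the universal PEL family has to
deliver; this file mints no named fact); the proof is the bookkeeping of
`weilFamilyReach_core_of_weilSystem` with `H` threaded through, the non-vanishing of the transported
class (`FiberClass.ne_zero_of_isSmoothProjectiveFamily_of_eq_mk`) and the flip of the isogeny pair
(`Motives.AbelianVariety.exists_isogenyPair_flip`).
[cite: Deligne1982HodgeCycles, proof of Thm. 4.8 (pp. 47–52) with Prop. 4.4]
[cite: vanGeemen1994HodgeAV, Lemma 5.2, 5.3–5.4 and 5.8–5.11]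
[cite: MumfordFogartyKirwan1994, Thm. 7.9–7.10] [cite: Milne1986AbelianVarieties, §8 Prop. 8.1] -/
theorem weilFamilyReach_hyperbolic_of_polarizedWeilSystem
    (h : ∀ (n d : ℕ), 1 ≤ n → 1 ≤ d →
      ∀ (P : AbelianVariety ℂ) (ψ₀ : P ⟶ P) (e : ProjectiveEmbedding P.X)
        (a : complexBetti (projectiveSpace e.n ℂ) 2),
        P.dim = 2 * n → ψ₀ ≫ ψ₀ = -((d : ℤ) • 𝟙 P) → IsRationalClass a → a ≠ 0 →
        IsHyperbolicWeilType P ψ₀ n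
          ((d : ℂ) • complexBetti.map e.ι 2 a +
            complexBetti.map ψ₀.hom.hom.hom 2 (complexBetti.map e.ι 2 a)) →
        ∃ (𝒳 S : SchemeOver ℂ) (f : 𝒳 ⟶ S) (s₀ : ComplexPoints S) (e' : P.X ≅ fiberOver f s₀)
          (Y : ComplexPoints S → AbelianVariety ℂ) (Ψ : ∀ s, Y s ⟶ Y s)
          (ε : ∀ s, (Y s).X ≅ fiberOver f s) (H : complexBetti 𝒳 2),
          IsSmoothProjectiveFamily f (2 * n) ∧
          (∃ (N : ℕ) (ι : 𝒳 ⟶ CategoryTheory.MonoidalCategoryStruct.tensorObj (projectiveSpace N ℂ) S),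
            AlgebraicGeometry.IsClosedImmersion ι.left ∧
              ι ≫ CategoryTheory.CartesianMonoidalCategory.snd (projectiveSpace N ℂ) S = f) ∧
          IrreducibleSpace S.left ∧ AlgebraicGeometry.Smooth S.hom ∧ IsQuasiProjectiveOver S ∧
          (∀ s, (Y s).dim = 2 * n ∧ Ψ s ≫ Ψ s = -((d : ℤ) • 𝟙 (Y s))) ∧
          (∀ w : complexBetti P.X (2 * n), w ∈ weilClassesOf P ψ₀ n d →
            ∃ σ : ComplexPoints S → FiberClass f (2 * n),
              Continuous σ ∧ σ s₀ = ⟨s₀, complexBetti.map e'.inv (2 * n) w⟩ ∧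
              ∀ s, ∃ x : complexBetti (fiberOver f s) (2 * n), σ s = ⟨s, x⟩ ∧
                IsOfHodgeType (2 * n) (fiberOver f s) (2 * n) n n x ∧
                complexBetti.map (ε s).hom (2 * n) x ∈ weilClassesOf (Y s) (Ψ s) n d) ∧
          (∀ (A : AbelianVariety ℂ) (φ : A ⟶ A) (eA : ProjectiveEmbedding A.X)
            (aA : complexBetti (projectiveSpace eA.n ℂ) 2),
            A.dim = 2 * n → φ ≫ φ = -((d : ℤ) • 𝟙 A) → IsRationalClass aA → aA ≠ 0 →
            IsHyperbolicWeilType A φ n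
              ((d : ℂ) • complexBetti.map eA.ι 2 aA +
                complexBetti.map φ.hom.hom.hom 2 (complexBetti.map eA.ι 2 aA)) →
            ∃ (s : ComplexPoints S) (u : Y s ⟶ A) (v : A ⟶ Y s) (m : ℕ),
              AlgebraicGeometry.Flat u.hom.hom.hom.left ∧ 0 < m ∧ u ≫ v = m • 𝟙 (Y s) ∧
                v ≫ Ψ s = φ ≫ v) ∧
          (∀ s : ComplexPoints S,
            IsRationalClass (complexBetti.map (fiberι f s) 2 H) ∧
              IsOfHodgeType (2 * n) (fiberOver f s) 2 1 1 (complexBetti.map (fiberι f s) 2 H)) ∧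
          complexBetti.map e'.hom 2 (complexBetti.map (fiberι f s₀) 2 H) =
            (d : ℂ) • complexBetti.map e.ι 2 a +
              complexBetti.map ψ₀.hom.hom.hom 2 (complexBetti.map e.ι 2 a)) :
    weilFamilyReach_hyperbolic := by
  intro n d hn hd P ψ₀ e a hP hψ ha ha0 hhyp w hw hw0 A φ eA aA hA hφ haA haA0 hhypA
  have hψ' : ψ₀ ≫ ψ₀ = -((d : ℤ) • 𝟙 P) := by rw [natCast_zsmul]; exact hψ
  have hφ' : φ ≫ φ = -((d : ℤ) • 𝟙 A) := by rw [natCast_zsmul]; exact hφ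
  obtain ⟨𝒳, S, f, s₀, e', Y, Ψ, ε, H, hfam, hemb, hirr, hsm, hqp, hYΨ, hsec, hreach, hH, hH₀⟩ :=
    h n d hn hd P ψ₀ e a hP hψ' ha ha0 hhyp
  obtain ⟨σ, hσ, hσ₀, hval⟩ := hsec w hw
  obtain ⟨s₁, u, v, m, -, hm, huv, hv⟩ := hreach A φ eA aA hA hφ' haA haA0 hhypA
  have hpt : ∀ s, (σ s).pt = s := fun s ↦ by
    obtain ⟨x, hx, -, -⟩ := hval s
    rw [hx]
  obtain ⟨x₁, hx₁, -, hx₁W⟩ := hval s₁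
  -- flip the isogeny pair `u : Y s₁ → A`, `v : A → Y s₁` (`dim Y s₁ = dim A`, characteristic `0`)
  obtain ⟨u', v', m', hm', hu'v', -, -, -, hfl, hv'φ, -⟩ :=
    AbelianVariety.exists_isogenyPair_flip hm huv ((hYΨ s₁).1.trans hA.symm) hv
  refine ⟨𝒳, S, f, s₀, s₁, e', Y s₁, Ψ s₁, ε s₁, σ, H, hfam, hemb, hirr, hsm, hqp, fun s ↦ ?_, hH,
    hH₀, hσ, hpt, fun s ↦ ?_, hσ₀, (hYΨ s₁).1, ?_, ⟨u', v', m', hm', hu'v', hfl, hv'φ⟩, x₁, hx₁,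
    hx₁W, ?_⟩
  · -- every fibre is a `√-d`-abelian `2n`-fold
    exact ⟨Y s, Ψ s, (hYΨ s).1, by rw [(hYΨ s).2, natCast_zsmul], ⟨ε s⟩⟩
  · -- the values of `σ` are of Hodge type `(n, n)`
    obtain ⟨x, hx, hHt, -⟩ := hval s
    rw [hx]
    exact hHt
  · rw [(hYΨ s₁).2, natCast_zsmul]
  · -- the transported class is non-zero: flat sections through `e'^{-1 *} w ≠ 0` vanish nowhere
    refine complexBetti.map_ne_zero_of_iso (ε s₁) (2 * n) ?_
    exact FiberClass.ne_zero_of_isSmoothProjectiveFamily_of_eq_mk f (2 * n) hfam hirr hsm hqp hσ hpt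
      hσ₀ (complexBetti.map_ne_zero_of_iso e'.symm (2 * n) hw0) hx₁

/-- The polarized family-first package implies the family-first fact
`weilFamily_hyperbolic_weilSystem_reach` (forget `H`). [cite: Deligne1982HodgeCycles, proof of Thm. 4.8 (pp. 47–52)] -/
theorem weilFamily_hyperbolic_weilSystem_reach_of_polarizedWeilSystem
    (h : ∀ (n d : ℕ), 1 ≤ n → 1 ≤ d →
      ∀ (P : AbelianVariety ℂ) (ψ₀ : P ⟶ P) (e : ProjectiveEmbedding P.X)
        (a : complexBetti (projectiveSpace e.n ℂ) 2),
        P.dim = 2 * n → ψ₀ ≫ ψ₀ = -((d : ℤ) • 𝟙 P) → IsRationalClass a → a ≠ 0 →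
        IsHyperbolicWeilType P ψ₀ n
          ((d : ℂ) • complexBetti.map e.ι 2 a +
            complexBetti.map ψ₀.hom.hom.hom 2 (complexBetti.map e.ι 2 a)) →
        ∃ (𝒳 S : SchemeOver ℂ) (f : 𝒳 ⟶ S) (s₀ : ComplexPoints S) (e' : P.X ≅ fiberOver f s₀)
          (Y : ComplexPoints S → AbelianVariety ℂ) (Ψ : ∀ s, Y s ⟶ Y s)
          (ε : ∀ s, (Y s).X ≅ fiberOver f s) (H : complexBetti 𝒳 2),
          IsSmoothProjectiveFamily f (2 * n) ∧
          (∃ (N : ℕ) (ι : 𝒳 ⟶ CategoryTheory.MonoidalCategoryStruct.tensorObj (projectiveSpace N ℂ) S),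
            AlgebraicGeometry.IsClosedImmersion ι.left ∧
              ι ≫ CategoryTheory.CartesianMonoidalCategory.snd (projectiveSpace N ℂ) S = f) ∧
          IrreducibleSpace S.left ∧ AlgebraicGeometry.Smooth S.hom ∧ IsQuasiProjectiveOver S ∧
          (∀ s, (Y s).dim = 2 * n ∧ Ψ s ≫ Ψ s = -((d : ℤ) • 𝟙 (Y s))) ∧
          (∀ w : complexBetti P.X (2 * n), w ∈ weilClassesOf P ψ₀ n d →
            ∃ σ : ComplexPoints S → FiberClass f (2 * n),
              Continuous σ ∧ σ s₀ = ⟨s₀, complexBetti.map e'.inv (2 * n) w⟩ ∧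
              ∀ s, ∃ x : complexBetti (fiberOver f s) (2 * n), σ s = ⟨s, x⟩ ∧
                IsOfHodgeType (2 * n) (fiberOver f s) (2 * n) n n x ∧
                complexBetti.map (ε s).hom (2 * n) x ∈ weilClassesOf (Y s) (Ψ s) n d) ∧
          (∀ (A : AbelianVariety ℂ) (φ : A ⟶ A) (eA : ProjectiveEmbedding A.X)
            (aA : complexBetti (projectiveSpace eA.n ℂ) 2),
            A.dim = 2 * n → φ ≫ φ = -((d : ℤ) • 𝟙 A) → IsRationalClass aA → aA ≠ 0 →
            IsHyperbolicWeilType A φ n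
              ((d : ℂ) • complexBetti.map eA.ι 2 aA +
                complexBetti.map φ.hom.hom.hom 2 (complexBetti.map eA.ι 2 aA)) →
            ∃ (s : ComplexPoints S) (u : Y s ⟶ A) (v : A ⟶ Y s) (m : ℕ),
              AlgebraicGeometry.Flat u.hom.hom.hom.left ∧ 0 < m ∧ u ≫ v = m • 𝟙 (Y s) ∧
                v ≫ Ψ s = φ ≫ v) ∧
          (∀ s : ComplexPoints S,
            IsRationalClass (complexBetti.map (fiberι f s) 2 H) ∧
              IsOfHodgeType (2 * n) (fiberOver f s) 2 1 1 (complexBetti.map (fiberι f s) 2 H)) ∧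
          complexBetti.map e'.hom 2 (complexBetti.map (fiberι f s₀) 2 H) =
            (d : ℂ) • complexBetti.map e.ι 2 a +
              complexBetti.map ψ₀.hom.hom.hom 2 (complexBetti.map e.ι 2 a)) :
    weilFamily_hyperbolic_weilSystem_reach := by
  intro n d hn hd P ψ₀ e a hP hψ ha ha0 hhyp
  obtain ⟨𝒳, S, f, s₀, e', Y, Ψ, ε, -, hfam, hemb, hirr, hsm, hqp, hYΨ, hsec, hreach, -, -⟩ :=
    h n d hn hd P ψ₀ e a hP hψ ha ha0 hhyp
  exact ⟨𝒳, S, f, s₀, e', Y, Ψ, ε, hfam, hemb, hirr, hsm, hqp, hYΨ, hsec, hreach⟩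

end Literature.AlgebraicGeometry.HodgeTheory

end
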